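import Mathlib.LinearAlgebra.Trace
import Mathlib.LinearAlgebra.Eigenspace.Basic
import Mathlib.LinearAlgebra.FiniteDimensional.Lemmas
import Mathlib.LinearAlgebra.Dimension.OrzechProperty
import Mathlib.Analysis.Complex.Basic
import Mathlib.NumberTheory.Real.Irrational
import HarnessLib

/-!
# Route HeckePrymWeil · crux `WeilSixfoldsSqrtMinus7` (stmt-HodgeConjecture-1260) · line
# `real-quadratic-base-change` · stub `stub_oneClassSuffices` — part 1/3: generic linear algebra

Pure linear algebra over `ℂ` (no geometry) for the "one class suffices" step on an abelian 12-fold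
with multiplication by the CM field `L = ℚ(√-7, √t)` (sibling files `…OneClassSufficesEigenlines`,
`…OneClassSuffices`): two COMMUTING involutions `κ, φ` of a finite-dimensional space
(`κ = ψ_K^*/(i√7)`, `φ = ψ_F^*/√t` on `H¹`) with `tr κ = tr φ = tr κφ = 0` cut it into four joint
eigenspaces of EQUAL dimension (the idempotents `¼(1 ± κ)(1 ± φ)` have equal traces, and the trace
of an idempotent is its rank, Mathlib `LinearMap.IsProj.trace`); a basis adapted to the four
pieces (head theorem `oneClassSuffices_adaptedBasis`, a registered sub-goal of the crux item); the
trace of an operator with `K² = s²` is an integer multiple of `s`; the small arithmetic of `i√7`,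
`√t` showing that these integers vanish when the traces are rational, `(1 ± √t)⁶ ∉ ℚ`, and the real
eigenvalue separation `(1+ρ)ᵃ(1-ρ)ᵇ ≠ (1+ρ)ⁿ`. Everything is a theorem; no definition, no named fact.
-/

noncomputable section

-- single-problem summit (Problem = Summit): the mandated namespace repeats `HodgeConjecture`.
set_option linter.dupNamespace false

namespace Summit.HodgeConjecture.HodgeConjecture.Theorems.WeilSixfoldsSqrtMinus7.RealQuadraticBaseChange

/-! ### Involutions, the idempotents `½(1 + εκ)` and their traces -/

section Involutions

variable {V : Type*} [AddCommGroup V] [Module ℂ V]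

/-- `½(1 + εκ)` is idempotent for an involution `κ` and a sign `ε = ±1`. [folklore] -/
theorem isIdempotentElem_half_one_add_smul {κ : Module.End ℂ V} (hκ : κ * κ = 1) {ε : ℂ}
    (hε : ε = 1 ∨ ε = -1) : IsIdempotentElem ((2 : ℂ)⁻¹ • (1 + ε • κ) : Module.End ℂ V) := by
  rw [IsIdempotentElem, smul_mul_smul_comm, mul_add, add_mul, add_mul, one_mul, mul_one, one_mul,
    smul_mul_smul_comm, hκ]
  rcases hε with rfl | rfl <;> module

/-- `κ · ½(1 + εκ) = ε · ½(1 + εκ)`: the idempotent lands in the `ε`-eigenspace of `κ`. [folklore] -/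
theorem mul_half_one_add_smul {κ : Module.End ℂ V} (hκ : κ * κ = 1) {ε : ℂ} (hε : ε = 1 ∨ ε = -1) :
    κ * ((2 : ℂ)⁻¹ • (1 + ε • κ)) = ε • ((2 : ℂ)⁻¹ • (1 + ε • κ) : Module.End ℂ V) := by
  rw [mul_smul_comm, mul_add, mul_one, mul_smul_comm, hκ]
  rcases hε with rfl | rfl <;> module

/-- On the `ε`-eigenspace of `κ` the idempotent `½(1 + εκ)` is the identity. [folklore] -/
theorem half_one_add_smul_apply_of_mem {κ : Module.End ℂ V} {ε : ℂ} (hε : ε = 1 ∨ ε = -1) {v : V}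
    (hv : v ∈ κ.eigenspace ε) : ((2 : ℂ)⁻¹ • (1 + ε • κ) : Module.End ℂ V) v = v := by
  rw [Module.End.mem_eigenspace_iff] at hv
  rw [LinearMap.smul_apply, LinearMap.add_apply, LinearMap.smul_apply, hv, Module.End.one_apply]
  rcases hε with rfl | rfl <;> module

/-- **The trace of an involution is an integer** (`= dim V₊ - dim V₋`): `κ = P₊ - P₋` with
`P± = ½(1 ± κ)` idempotent, and the trace of an idempotent is the rank of its image
(`LinearMap.IsProj.trace`). [folklore] -/
theorem exists_int_trace_eq_of_mul_self_eq_one [FiniteDimensional ℂ V] {κ : Module.End ℂ V}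
    (hκ : κ * κ = 1) : ∃ m : ℤ, LinearMap.trace ℂ V κ = m := by
  have hP := (LinearMap.IsIdempotentElem.isProj_range _
    (isIdempotentElem_half_one_add_smul hκ (Or.inl rfl))).trace
  have hQ := (LinearMap.IsIdempotentElem.isProj_range _
    (isIdempotentElem_half_one_add_smul hκ (Or.inr rfl))).trace
  have e : κ = (2 : ℂ)⁻¹ • (1 + (1 : ℂ) • κ) - (2 : ℂ)⁻¹ • (1 + (-1 : ℂ) • κ) := by module
  refine ⟨(Module.finrank ℂ (LinearMap.range ((2 : ℂ)⁻¹ • (1 + (1 : ℂ) • κ) : Module.End ℂ V)) : ℤ) -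
    Module.finrank ℂ (LinearMap.range ((2 : ℂ)⁻¹ • (1 + (-1 : ℂ) • κ) : Module.End ℂ V)), ?_⟩
  conv_lhs => rw [e]
  rw [map_sub, hP, hQ]
  push_cast
  ring

/-- `K/s` is an involution when `K² = s²`, `s ≠ 0`. [folklore] -/
theorem inv_smul_mul_inv_smul_eq_one {K : Module.End ℂ V} {s : ℂ} (hs : s ≠ 0)
    (hK : K * K = (s ^ 2) • (1 : Module.End ℂ V)) : (s⁻¹ • K) * (s⁻¹ • K) = 1 := by
  rw [smul_mul_smul_comm, hK, smul_smul, show s⁻¹ * s⁻¹ * s ^ 2 = 1 by field_simp, one_smul]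

/-- **`tr K ∈ s·ℤ` when `K² = s²`** (`s ≠ 0`): `K/s` is an involution. [folklore] -/
theorem exists_int_trace_eq_mul_of_mul_self [FiniteDimensional ℂ V] {K : Module.End ℂ V} {s : ℂ}
    (hs : s ≠ 0) (hK : K * K = (s ^ 2) • (1 : Module.End ℂ V)) :
    ∃ m : ℤ, LinearMap.trace ℂ V K = s * m := by
  obtain ⟨m, hm⟩ := exists_int_trace_eq_of_mul_self_eq_one (inv_smul_mul_inv_smul_eq_one hs hK)
  refine ⟨m, ?_⟩
  have e : K = s • (s⁻¹ • K) := by rw [smul_smul, mul_inv_cancel₀ hs, one_smul]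
  rw [e, map_smul, hm, smul_eq_mul]

end Involutions

/-! ### Two commuting involutions: the four joint idempotents `¼(1 + εκ)(1 + ε'φ)` -/

section TwoInvolutions

variable {V : Type*} [AddCommGroup V] [Module ℂ V] {κ φ : Module.End ℂ V}

/-- The joint idempotent `½(1 + εκ) · ½(1 + ε'φ)` maps into the joint eigenspace
`ker(κ - ε) ∩ ker(φ - ε')` (`κ`, `φ` commuting involutions). [folklore] -/
theorem half_mul_half_apply_mem (hκ : κ * κ = 1) (hφ : φ * φ = 1) (hκφ : κ * φ = φ * κ) {ε ε' : ℂ}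
    (hε : ε = 1 ∨ ε = -1) (hε' : ε' = 1 ∨ ε' = -1) (v : V) :
    (((2 : ℂ)⁻¹ • (1 + ε • κ)) * ((2 : ℂ)⁻¹ • (1 + ε' • φ)) : Module.End ℂ V) v ∈
      κ.eigenspace ε ⊓ φ.eigenspace ε' := by
  have hcomm : Commute ((2 : ℂ)⁻¹ • (1 + ε • κ) : Module.End ℂ V) ((2 : ℂ)⁻¹ • (1 + ε' • φ)) :=
    (((Commute.one_left _).add_left ((Commute.one_right _).add_right
      (((show Commute κ φ from hκφ).smul_left ε).smul_right ε'))).smul_left _).smul_right _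
  refine ⟨?_, ?_⟩
  · rw [SetLike.mem_coe, Module.End.mem_eigenspace_iff, ← Module.End.mul_apply, ← mul_assoc,
      mul_half_one_add_smul hκ hε, smul_mul_assoc, LinearMap.smul_apply]
  · rw [SetLike.mem_coe, Module.End.mem_eigenspace_iff, ← Module.End.mul_apply, hcomm.eq,
      ← mul_assoc, mul_half_one_add_smul hφ hε', smul_mul_assoc, LinearMap.smul_apply]

/-- On the joint eigenspace the joint idempotent is the identity. [folklore] -/
theorem half_mul_half_apply_of_mem {ε ε' : ℂ} (hε : ε = 1 ∨ ε = -1) (hε' : ε' = 1 ∨ ε' = -1) {v : V}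
    (hv : v ∈ κ.eigenspace ε ⊓ φ.eigenspace ε') :
    (((2 : ℂ)⁻¹ • (1 + ε • κ)) * ((2 : ℂ)⁻¹ • (1 + ε' • φ)) : Module.End ℂ V) v = v := by
  rw [Module.End.mul_apply, half_one_add_smul_apply_of_mem hε' hv.2,
    half_one_add_smul_apply_of_mem hε hv.1]

/-- The image of the joint idempotent IS the joint eigenspace. [folklore] -/
theorem range_half_mul_half (hκ : κ * κ = 1) (hφ : φ * φ = 1) (hκφ : κ * φ = φ * κ) {ε ε' : ℂ}
    (hε : ε = 1 ∨ ε = -1) (hε' : ε' = 1 ∨ ε' = -1) :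
    LinearMap.range (((2 : ℂ)⁻¹ • (1 + ε • κ)) * ((2 : ℂ)⁻¹ • (1 + ε' • φ)) : Module.End ℂ V) =
      κ.eigenspace ε ⊓ φ.eigenspace ε' := by
  refine le_antisymm ?_ fun v hv => ⟨v, half_mul_half_apply_of_mem hε hε' hv⟩
  rintro _ ⟨w, rfl⟩
  exact half_mul_half_apply_mem hκ hφ hκφ hε hε' w

/-- **Every vector is the sum of its four joint components** `¼(1 ± κ)(1 ± φ) v`. [folklore] -/
theorem sum_half_mul_half_apply (v : V) :
    v = ((((2 : ℂ)⁻¹ • (1 + (1 : ℂ) • κ)) * ((2 : ℂ)⁻¹ • (1 + (1 : ℂ) • φ)) : Module.End ℂ V) v +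
          (((2 : ℂ)⁻¹ • (1 + (1 : ℂ) • κ)) * ((2 : ℂ)⁻¹ • (1 + (-1 : ℂ) • φ)) : Module.End ℂ V) v) +
        ((((2 : ℂ)⁻¹ • (1 + (-1 : ℂ) • κ)) * ((2 : ℂ)⁻¹ • (1 + (1 : ℂ) • φ)) : Module.End ℂ V) v +
          (((2 : ℂ)⁻¹ • (1 + (-1 : ℂ) • κ)) * ((2 : ℂ)⁻¹ • (1 + (-1 : ℂ) • φ)) : Module.End ℂ V)
            v) := by
  have h1 :
      ((2 : ℂ)⁻¹ • (1 + (1 : ℂ) • κ) : Module.End ℂ V) + (2 : ℂ)⁻¹ • (1 + (-1 : ℂ) • κ) = 1 := by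
    module
  have h2 :
      ((2 : ℂ)⁻¹ • (1 + (1 : ℂ) • φ) : Module.End ℂ V) + (2 : ℂ)⁻¹ • (1 + (-1 : ℂ) • φ) = 1 := by
    module
  simp only [← LinearMap.add_apply, ← mul_add, h1, h2, mul_one, Module.End.one_apply]

/-- **The four joint eigenspaces of two commuting traceless involutions have equal dimension
`¼ dim V`**: the joint idempotent `P = ¼(1 + εκ + ε'φ + εε'κφ)` has `tr P = ¼ dim V` when
`tr κ = tr φ = tr κφ = 0`, and `tr P = dim (im P)` (`LinearMap.IsProj.trace`). [folklore] -/
theorem four_mul_finrank_inf_eigenspace [FiniteDimensional ℂ V] (hκ : κ * κ = 1) (hφ : φ * φ = 1)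
    (hκφ : κ * φ = φ * κ) (htκ : LinearMap.trace ℂ V κ = 0) (htφ : LinearMap.trace ℂ V φ = 0)
    (htκφ : LinearMap.trace ℂ V (κ * φ) = 0) {ε ε' : ℂ} (hε : ε = 1 ∨ ε = -1)
    (hε' : ε' = 1 ∨ ε' = -1) :
    4 * Module.finrank ℂ ↥(κ.eigenspace ε ⊓ φ.eigenspace ε') = Module.finrank ℂ V := by
  have hcomm : Commute ((2 : ℂ)⁻¹ • (1 + ε • κ) : Module.End ℂ V) ((2 : ℂ)⁻¹ • (1 + ε' • φ)) :=
    (((Commute.one_left _).add_left ((Commute.one_right _).add_right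
      (((show Commute κ φ from hκφ).smul_left ε).smul_right ε'))).smul_left _).smul_right _
  have hP :
      IsIdempotentElem (((2 : ℂ)⁻¹ • (1 + ε • κ)) * ((2 : ℂ)⁻¹ • (1 + ε' • φ)) : Module.End ℂ V) :=
    (isIdempotentElem_half_one_add_smul hκ hε).mul_of_commute hcomm
      (isIdempotentElem_half_one_add_smul hφ hε')
  have htr := (LinearMap.IsIdempotentElem.isProj_range _ hP).trace
  rw [range_half_mul_half hκ hφ hκφ hε hε'] at htr
  rw [smul_mul_smul_comm, mul_add, add_mul, add_mul, one_mul, mul_one, one_mul, smul_mul_smul_comm,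
    map_smul, map_add, map_add, map_add, map_smul, map_smul, map_smul, LinearMap.trace_one, htκ, htφ,
    htκφ, smul_zero, smul_zero, smul_zero, add_zero, add_zero, add_zero, smul_eq_mul] at htr
  have h4 : ((4 * Module.finrank ℂ ↥(κ.eigenspace ε ⊓ φ.eigenspace ε') : ℕ) : ℂ) =
      (Module.finrank ℂ V : ℂ) := by
    push_cast
    rw [← htr]
    ring
  exact_mod_cast h4

end TwoInvolutions

section AdaptedBasis

/-- **A basis adapted to two commuting traceless involutions** (head theorem of this file). If
`dim V = 4n` and `κ`, `φ` are commuting involutions with `tr κ = tr φ = tr κφ = 0`, there is a basis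
`b` of joint eigenvectors, `κ bⱼ = ε_K(j) bⱼ`, `φ bⱼ = ε_F(j) bⱼ` with signs `ε_K(j), ε_F(j) = ±1`,
in which every sign pattern `(ε, ε')` occurs at most (in fact exactly) `n` times: concatenate bases
of the four joint eigenspaces, each of dimension `n` (`four_mul_finrank_inf_eigenspace`); they span
because `v = Σ ¼(1 ± κ)(1 ± φ) v`. [folklore] -/
theorem oneClassSuffices_adaptedBasis :
    ∀ {V : Type} [AddCommGroup V] [Module ℂ V] [FiniteDimensional ℂ V] {κ φ : Module.End ℂ V},
      κ * κ = 1 → φ * φ = 1 → κ * φ = φ * κ → LinearMap.trace ℂ V κ = 0 →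
      LinearMap.trace ℂ V φ = 0 → LinearMap.trace ℂ V (κ * φ) = 0 → ∀ {n : ℕ},
      Module.finrank ℂ V = 4 * n →
      ∃ (b : Module.Basis (Fin (4 * n)) ℂ V) (εK εF : Fin (4 * n) → ℂ),
        (∀ j, εK j = 1 ∨ εK j = -1) ∧ (∀ j, εF j = 1 ∨ εF j = -1) ∧
        (∀ j, κ (b j) = εK j • b j) ∧ (∀ j, φ (b j) = εF j • b j) ∧
        ∀ ε ε' : ℂ, (Finset.univ.filter fun j => εK j = ε ∧ εF j = ε').card ≤ n := by
  intro V _ _ _ κ φ hκ hφ hκφ htκ htφ htκφ n hn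
  classical
  -- the signs `±1` indexed by `Bool` and the four joint eigenspaces
  let sg : Bool → ℂ := fun a => cond a 1 (-1)
  have hsg : ∀ a, sg a = 1 ∨ sg a = -1 := by
    rintro (_ | _)
    · exact Or.inr rfl
    · exact Or.inl rfl
  have hsg_inj : Function.Injective sg := by
    rintro (_ | _) (_ | _) h
    · rfl
    · exact absurd h (by change (-1 : ℂ) ≠ 1; norm_num)
    · exact absurd h (by change (1 : ℂ) ≠ -1; norm_num)
    · rfl
  let N : Bool × Bool → Submodule ℂ V := fun q => κ.eigenspace (sg q.1) ⊓ φ.eigenspace (sg q.2)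
  have hN : ∀ q, Module.finrank ℂ (N q) = n := fun q => by
    have h := four_mul_finrank_inf_eigenspace hκ hφ hκφ htκ htφ htκφ (hsg q.1) (hsg q.2)
    rw [hn] at h
    change 4 * Module.finrank ℂ (N q) = 4 * n at h
    omega
  let bq : ∀ q, Module.Basis (Fin n) ℂ (N q) := fun q => Module.finBasisOfFinrankEq ℂ (N q) (hN q)
  let f : (Bool × Bool) × Fin n → V := fun i => (bq i.1 i.2 : V)
  have hf_mem : ∀ i, f i ∈ N i.1 := fun i => (bq i.1 i.2).2
  -- the concatenated family spans
  have hNle : ∀ q, N q ≤ Submodule.span ℂ (Set.range f) := by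
    intro q x hx
    have e : x = ∑ k, (bq q).repr ⟨x, hx⟩ k • (bq q k : V) := by
      have h := congrArg (fun y : N q => (y : V)) ((bq q).sum_repr ⟨x, hx⟩)
      simp only [AddSubmonoidClass.coe_finsetSum, SetLike.val_smul] at h
      exact h.symm
    rw [e]
    exact Submodule.sum_mem _ fun k _ => Submodule.smul_mem _ _ (Submodule.subset_span ⟨⟨q, k⟩, rfl⟩)
  have hspan : ⊤ ≤ Submodule.span ℂ (Set.range f) := by
    rintro v -
    rw [sum_half_mul_half_apply (κ := κ) (φ := φ) v]
    refine Submodule.add_mem _ (Submodule.add_mem _ ?_ ?_) (Submodule.add_mem _ ?_ ?_)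
    · exact hNle (true, true) (half_mul_half_apply_mem hκ hφ hκφ (Or.inl rfl) (Or.inl rfl) v)
    · exact hNle (true, false) (half_mul_half_apply_mem hκ hφ hκφ (Or.inl rfl) (Or.inr rfl) v)
    · exact hNle (false, true) (half_mul_half_apply_mem hκ hφ hκφ (Or.inr rfl) (Or.inl rfl) v)
    · exact hNle (false, false) (half_mul_half_apply_mem hκ hφ hκφ (Or.inr rfl) (Or.inr rfl) v)
  have hcard : Fintype.card ((Bool × Bool) × Fin n) = 4 * n := by
    simp only [Fintype.card_prod, Fintype.card_bool, Fintype.card_fin]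
  let B₀ : Module.Basis ((Bool × Bool) × Fin n) ℂ V :=
    basisOfTopLeSpanOfCardEqFinrank f hspan (hcard.trans hn.symm)
  have hB₀ : ∀ i, B₀ i = f i := fun i => congrFun (coe_basisOfTopLeSpanOfCardEqFinrank f hspan _) i
  let e : ((Bool × Bool) × Fin n) ≃ Fin (4 * n) := Fintype.equivFinOfCardEq hcard
  let b : Module.Basis (Fin (4 * n)) ℂ V := B₀.reindex e
  have hb : ∀ j, b j = f (e.symm j) := fun j => by rw [Module.Basis.reindex_apply, hB₀]
  refine ⟨b, fun j => sg (e.symm j).1.1, fun j => sg (e.symm j).1.2, fun j => hsg _, fun j => hsg _,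
    fun j => ?_, fun j => ?_, fun ε ε' => ?_⟩
  · rw [hb]; exact Module.End.mem_eigenspace_iff.1 (hf_mem (e.symm j)).1
  · rw [hb]; exact Module.End.mem_eigenspace_iff.1 (hf_mem (e.symm j)).2
  · -- `j ↦ (e.symm j).2 : Fin (4n) → Fin n` is injective on the pattern `(ε, ε')`
    calc (Finset.univ.filter fun j => sg (e.symm j).1.1 = ε ∧ sg (e.symm j).1.2 = ε').card
        ≤ (Finset.univ : Finset (Fin n)).card :=
          Finset.card_le_card_of_injOn (fun j => (e.symm j).2) (fun j _ => by simp) ?_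
      _ = n := by rw [Finset.card_univ, Fintype.card_fin]
    intro j hj j' hj' hjj'
    rw [Finset.coe_filter] at hj hj'
    obtain ⟨-, h1, h2⟩ := hj
    obtain ⟨-, h1', h2'⟩ := hj'
    apply e.symm.injective
    exact Prod.ext (Prod.ext (hsg_inj (h1.trans h1'.symm)) (hsg_inj (h2.trans h2'.symm))) hjj'

end AdaptedBasis

/-! ### Arithmetic: `ℚ ∩ i x ℤ = 0`, `ℚ ∩ √t ℤ = 0`, `(1 ± √t)⁶ ∉ ℚ`, separation of
`(1 ± √t)ᵃ(1 ∓ √t)ᵇ` -/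

section Arithmetic

/-- A rational number equal to `i·x·m` (`x > 0` real, `m` an integer) forces `m = 0` (imaginary
parts). [folklore] -/
theorem int_eq_zero_of_ratCast_eq_I_mul {q : ℚ} {x : ℝ} (hx : 0 < x) {m : ℤ}
    (h : (q : ℂ) = Complex.I * (x : ℂ) * m) : m = 0 := by
  have e : Complex.I * (x : ℂ) * m = Complex.I * ((x * m : ℝ) : ℂ) := by push_cast; ring
  rw [e] at h
  have him := congrArg Complex.im h
  rw [Complex.ratCast_im, Complex.I_mul_im, Complex.ofReal_re] at him
  rcases mul_eq_zero.1 him.symm with h0 | h0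
  · exact absurd h0 hx.ne'
  · exact_mod_cast h0

/-- A rational number equal to `√t·m` (`t` a non-square natural number, `m` an integer) forces
`m = 0` (`√t` is irrational, Mathlib `irrational_sqrt_natCast_iff`). [folklore] -/
theorem int_eq_zero_of_ratCast_eq_sqrt_mul {q : ℚ} {t : ℕ} (ht : ¬ IsSquare t) {m : ℤ}
    (h : (q : ℂ) = (Real.sqrt t : ℂ) * m) : m = 0 := by
  by_contra hm
  have h' : (q : ℝ) = Real.sqrt t * m := by exact_mod_cast h
  have hm' : (m : ℝ) ≠ 0 := by exact_mod_cast hm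
  refine (irrational_sqrt_natCast_iff.2 ht).ne_rat (q / m) ?_
  push_cast
  field_simp
  linarith

/-- **`(1 + ρ)⁶ ∉ ℚ` for an irrational `ρ` with `ρ² = t ∈ ℕ`** (e.g. `ρ = ±√t`, `t` non-square):
`(1 + ρ)⁶ = (1 + 15t + 15t² + t³) + (6 + 20t + 6t²) ρ` with a non-zero coefficient of `ρ`.
[folklore] -/
theorem one_add_pow_six_ne_ratCast {ρ : ℝ} (hirr : Irrational ρ) {t : ℕ} (hρ : ρ ^ 2 = t) (q : ℚ) :
    (1 + (ρ : ℂ)) ^ 6 ≠ (q : ℂ) := by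
  intro h
  have h' : (1 + ρ) ^ 6 = (q : ℝ) := by exact_mod_cast h
  have key : (1 + ρ) ^ 6 = (1 + 15 * t + 15 * (t : ℝ) ^ 2 + (t : ℝ) ^ 3) +
      (6 + 20 * t + 6 * (t : ℝ) ^ 2) * ρ := by
    linear_combination
      (ρ ^ 4 + 6 * ρ ^ 3 + (15 + t) * ρ ^ 2 + (20 + 6 * t) * ρ + (15 + 15 * t + (t : ℝ) ^ 2)) * hρ
  have hb : (6 + 20 * t + 6 * (t : ℝ) ^ 2) ≠ 0 := by positivity
  refine hirr.ne_rat ((q - (1 + 15 * t + 15 * (t : ℚ) ^ 2 + (t : ℚ) ^ 3)) /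
    (6 + 20 * t + 6 * (t : ℚ) ^ 2)) ?_
  push_cast
  field_simp
  linarith [key, h']

/-- **Real separation**: for a real `ρ` with `ρ ≠ 0`, `1 + ρ ≠ 0`, and `a + b = n`, `b ≥ 1`,
`(1 + ρ)ᵃ (1 - ρ)ᵇ ≠ (1 + ρ)ⁿ` (else `|1 - ρ| = |1 + ρ|`, i.e. `ρ = 0`). With `ρ = ±√t` this says
that no mixed wedge `⋀ᵃ V_{+√t} ⊗ ⋀ᵇ V_{-√t}` carries the eigenvalue `(1 ± √t)ⁿ` of `(𝟙 + ψ_F)^*`.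
[folklore] -/
theorem one_add_pow_mul_one_sub_pow_ne_of_real {ρ : ℝ} (h0 : ρ ≠ 0) (h1 : 1 + ρ ≠ 0) {n a b : ℕ}
    (hab : a + b = n) (hb : b ≠ 0) :
    (1 + (ρ : ℂ)) ^ a * (1 - (ρ : ℂ)) ^ b ≠ (1 + (ρ : ℂ)) ^ n := by
  intro h
  rw [← hab, pow_add] at h
  have h1' : (1 + (ρ : ℂ)) ^ a ≠ 0 := pow_ne_zero _ (by exact_mod_cast h1)
  have h2 : (1 - (ρ : ℂ)) ^ b = (1 + (ρ : ℂ)) ^ b := mul_left_cancel₀ h1' h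
  have h3 : (1 - ρ) ^ b = (1 + ρ) ^ b := by exact_mod_cast h2
  have h4 : |1 - ρ| = |1 + ρ| := by
    have h5 := congrArg (fun x : ℝ => |x|) h3
    simp only [abs_pow] at h5
    exact (pow_left_inj₀ (abs_nonneg _) (abs_nonneg _) hb).1 h5
  rcases abs_eq_abs.1 h4 with h6 | h6
  · exact h0 (by linarith)
  · linarith

end Arithmetic

/-! ### Lines -/

section Lines

variable {V : Type*} [AddCommGroup V] [Module ℂ V]

/-- A subspace contained in a line and containing a non-zero vector `c` of a subspace `S` is
contained in `S` (it is the line through `c`). [folklore] -/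
theorem le_of_le_span_singleton_of_mem {N S : Submodule ℂ V} {w c : V} (hN : N ≤ ℂ ∙ w)
    (hc : c ∈ N) (hc0 : c ≠ 0) (hcS : c ∈ S) : N ≤ S := by
  intro x hx
  obtain ⟨a, ha⟩ := Submodule.mem_span_singleton.1 (hN hc)
  obtain ⟨a', ha'⟩ := Submodule.mem_span_singleton.1 (hN hx)
  have ha0 : a ≠ 0 := by
    rintro rfl
    rw [zero_smul] at ha
    exact hc0 ha.symm
  have e : x = (a' * a⁻¹) • c := by
    rw [← ha', ← ha, smul_smul, mul_assoc, inv_mul_cancel₀ ha0, mul_one]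
  rw [e]
  exact S.smul_mem _ hcS

end Lines

end Summit.HodgeConjecture.HodgeConjecture.Theorems.WeilSixfoldsSqrtMinus7.RealQuadraticBaseChange

end
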